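/-
Cell b2b-lgcu-borel (gen 25).  VALUE = THEOREM (a law constraining every hypothetical witness of the
crux, all primes `p`, all dimensions `m`), NOT summit progress; the crux item `SubgroupIdentityDesigns`
(stmt-MatrixMultiplication-14079) stays open and untouched.
-/
import Mathlib
import Summits.MatrixMultiplication.MatrixMultiplication.Theorems.SubgroupIdentityDesigns.Negative.SemiregularLaw

/-!
# The fixed-point law: the Burnside form of the free-module law for an ARBITRARY subgroup `K`

Route `LevelGradedCohnUmans`, crux `SubgroupIdentityDesigns` (stmt-MatrixMultiplication-14079), cells
`(m, k) = (m, 1)`; report `run/shared/lean/b2b/levelgraded-cu/ORACLE-g25.md` §G25-1.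

`SemiregularLaw` evaluates the free-module law `(x + y − 1)·z ≤ |K| · dim (F_1)^K` (`FreeModuleLaw`,
`K ≤ H₃`) only for SEMIREGULAR `K` (no `k ≠ 1` fixes a non-zero vector), where Burnside's count is
`|Ω_K|·|K| = p^m + |K| − 1`.  This file evaluates it for EVERY subgroup `K`, in terms of the
**fixed-point excess**

  `Φ(K) = Σ_{k ∈ K, k ≠ 1} (p^{d(k)} − 1)`,  `d(k) = dim_{𝔽_p} Fix(k) = dim ker (k − 1)`

(`fixExcess`; `Φ(K) = 0` iff `K` is semiregular, `fixExcess_eq_zero_of_semiregular`).  Burnside's lemma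
with `|Fix(k)| = p^{d(k)}` (`card_fixedBy`) reads `|Ω_K|·|K| + 1 = p^m + |K| + Φ(K)`
(`card_orbits_mul_card`), and with the invariant-dimension bound `dim (F_1)^K ≤ 1 + b(|Ω_K| − 2)`
(`LevelOneInvariantDim.finrank_invRight_levelOne_le`, `b = #ℙ^{m-1}(𝔽_p) = (p^m − 1)/(p − 1)`) it gives
`|K|·dim (F_1)^K + |K|(b − 1) ≤ (p − 1) b² + b·Φ(K)` (`card_mul_finrank_le`).  Hence, writing
`x, y, z = |H₁|, |H₂|, |H₃|` for a hypothetical level-one witness (`SubgroupTPP` + a level-one identity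
design; any `ε`):

* `law_right` / `crux_law_right` — **`(x + y − 1)·z + |K|·(b − 1) ≤ (p − 1)·b² + b·Φ(K)`** for EVERY
  `K ≤ H₃`;  `law_left` / `crux_law_left` — `(z + y − 1)·x + |K|·(b − 1) ≤ (p − 1)·b² + b·Φ(K)` for
  every `K ≤ H₁` (reversal, `SemiregularLaw.tpp_reverse` / `comp_inv_mem` / `test_reverse`);
* `crux_member_right` / `crux_member_left` — the whole member `K = H₃` (resp. `K = H₁`):
  **`(x + y + b − 2)·z ≤ (p − 1)·b² + b·Φ(H₃)`** and `(z + y + b − 2)·x ≤ (p − 1)·b² + b·Φ(H₁)`.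

READING.  Non-semiregularity of (a subgroup of) an end member is paid for LINEARLY in its fixed-point
mass: the semiregular law is the case `Φ = 0`, and the law beats the Neumann count
`(x + y − 1) z ≤ (p − 1) b² − 2b + 2` (`WitnessNeumannCounts`) exactly when `b·Φ(K) < (b − 1)|K| − 2b + 2`,
i.e. roughly when `K` has fewer than one fixed direction per element (`Φ(K) < |K|`).  At the
LP-extremal shape of the counting laws (`x = z = u`, `y ≈ 2u`, `3u² ≈ (p − 1)b²`) the member form
forces `Φ(H₃) ≳ u` and `Φ(H₁) ≳ u`: the end members of any witness near that shape carry at least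
about one fixed non-zero vector per element on average (for `m = 3`: `(p² − 1)·#{axial elements} +
(p − 1)·#{elements fixing exactly a line} ≳ |H₃|`), which is where the single-member exclusions of
fixed-point-rich configurations (reflection classes, pencils, corner groups, …) take over.  This is
item (S-n) of the gen-20 successor menu (`ORACLE-g20.md` §G20-5), left open since.

HONEST SCOPE.  A law (an inequality every witness satisfies); it empties no `(p, m, ε)` cell by itself.
Sorry-free; standard axioms; the crux item is untouched.
-/

set_option linter.dupNamespace false

noncomputable section

open scoped BigOperators Classical Matrix LinearAlgebra.Projectivization
open Module (finrank)

namespace Summit.MatrixMultiplication.MatrixMultiplication.Theorems.SubgroupIdentityDesigns.Negative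
namespace FixedPointLaw

open Summit.MatrixMultiplication.MatrixMultiplication.Theorems.LieRankDesigns.Negative (GLm Mat)
open Summit.MatrixMultiplication.MatrixMultiplication.Theorems.LevelOneGL2Designs.Negative
  (levelSubmodule levelSubmodule_bi_inv)
open Literature.Barriers.MatrixMultiplication (SubgroupTPP)
open FreeModuleLaw (invRight card_mul_le_card_mul_finrank_invRight)
open LevelOneInvariantDim (Ω finrank_invRight_levelOne_le)
open SemiregularLaw (tpp_reverse comp_inv_mem test_reverse)
open PackingBridge (exists_test)

variable {p m : ℕ} [hp : Fact p.Prime]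

/-! ## Fixed spaces and the fixed-point excess -/

/-- The fixed space `Fix(g) = {v | g v = v} = ker (g − 1)` of `g ∈ GL_m(𝔽_p)`, a subspace of `𝔽_p^m`. -/
def fixSub (g : GLm p m) : Submodule (ZMod p) (Fin m → ZMod p) where
  carrier := {v | (g : Mat p m) *ᵥ v = v}
  add_mem' := by
    intro a c ha hc
    simp only [Set.mem_setOf_eq] at ha hc ⊢
    rw [Matrix.mulVec_add, ha, hc]
  zero_mem' := by simp only [Set.mem_setOf_eq, Matrix.mulVec_zero]
  smul_mem' := by
    intro c v hv
    simp only [Set.mem_setOf_eq] at hv ⊢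
    rw [Matrix.mulVec_smul, hv]

/-- Membership in the fixed space. -/
theorem mem_fixSub {g : GLm p m} {v : Fin m → ZMod p} : v ∈ fixSub g ↔ (g : Mat p m) *ᵥ v = v :=
  Iff.rfl

/-- `d(g) = dim_{𝔽_p} Fix(g)`, the multiplicity of the eigenvalue `1`. -/
def fixDim (g : GLm p m) : ℕ := finrank (ZMod p) (fixSub g)

/-- The identity fixes everything: `Fix(1) = 𝔽_p^m`. -/
theorem fixSub_one : fixSub (1 : GLm p m) = ⊤ := by
  ext v
  simp only [mem_fixSub, Submodule.mem_top, Units.val_one, Matrix.one_mulVec]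

/-- `d(1) = m`. -/
theorem fixDim_one : fixDim (1 : GLm p m) = m := by
  rw [fixDim, fixSub_one, finrank_top, Module.finrank_fin_fun]

/-- `|Fix(g)| = p^{d(g)}`. -/
theorem natCard_fixSub (g : GLm p m) : Nat.card (fixSub g) = p ^ fixDim g := by
  rw [Nat.card_eq_fintype_card, Module.card_eq_pow_finrank (K := ZMod p) (V := ↥(fixSub g)), ZMod.card]
  rfl

/-- The **fixed-point excess** `Φ(K) = Σ_{k ∈ K, k ≠ 1} (p^{d(k)} − 1)` of a subgroup `K ≤ GL_m(𝔽_p)`: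
the number of pairs `(k, v)`, `k ≠ 1`, `v ≠ 0`, `k v = v`.  It vanishes iff `K` is semiregular. -/
def fixExcess (K : Subgroup (GLm p m)) : ℕ :=
  ∑ k ∈ (Finset.univ : Finset K).erase 1, (p ^ fixDim (k : GLm p m) - 1)

/-- For a semiregular `K` (no `k ≠ 1` fixes a non-zero vector) the excess vanishes: `Φ(K) = 0`. -/
theorem fixExcess_eq_zero_of_semiregular (K : Subgroup (GLm p m))
    (hK : ∀ k : K, ∀ v : Fin m → ZMod p, v ≠ 0 → k • v = v → k = 1) : fixExcess K = 0 := by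
  refine Finset.sum_eq_zero fun k hk => ?_
  have hk1 : k ≠ 1 := Finset.ne_of_mem_erase hk
  have hbot : fixSub (k : GLm p m) = ⊥ := by
    rw [Submodule.eq_bot_iff]
    intro v hv
    by_contra hv0
    exact hk1 (hK k v hv0 hv)
  have hd : fixDim (k : GLm p m) = 0 := by rw [fixDim, hbot, finrank_bot]
  rw [hd, pow_zero, Nat.sub_self]

/-! ## Burnside with fixed spaces -/

/-- The fixed-point set of `k ∈ K` on vectors is its fixed space: `|fixedBy k| = p^{d(k)}`. -/
theorem card_fixedBy (K : Subgroup (GLm p m)) (k : K) :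
    Fintype.card (MulAction.fixedBy (Fin m → ZMod p) k) = p ^ fixDim (k : GLm p m) := by
  have hset : (MulAction.fixedBy (Fin m → ZMod p) k : Set (Fin m → ZMod p)) =
      (fixSub (k : GLm p m) : Set (Fin m → ZMod p)) := by
    ext v
    rw [MulAction.mem_fixedBy, SetLike.mem_coe, mem_fixSub]
    exact Iff.rfl
  rw [← Nat.card_eq_fintype_card, Nat.card_congr (Equiv.setCongr hset)]
  exact natCard_fixSub (k : GLm p m)

/-- **Burnside with fixed spaces**: `|Ω_K| · |K| + 1 = p^m + |K| + Φ(K)`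
(`|Ω_K|` = number of `K`-orbits on `𝔽_p^m`, including `{0}`). -/
theorem card_orbits_mul_card (K : Subgroup (GLm p m)) :
    Nat.card (Ω K) * Nat.card K + 1 = p ^ m + Nat.card K + fixExcess K := by
  have hB := MulAction.sum_card_fixedBy_eq_card_orbits_mul_card_group K (Fin m → ZMod p)
  simp only [card_fixedBy] at hB
  have hp1 : 1 ≤ p := hp.out.one_lt.le
  -- split off `k = 1` and rewrite `p^d = (p^d - 1) + 1` on the rest
  have hsplit : (∑ k : K, p ^ fixDim (k : GLm p m)) =
      p ^ m + ∑ k ∈ (Finset.univ : Finset K).erase 1, p ^ fixDim (k : GLm p m) := by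
    rw [← Finset.add_sum_erase _ _ (Finset.mem_univ (1 : K))]
    simp only [Subgroup.coe_one, fixDim_one]
  have hrest : (∑ k ∈ (Finset.univ : Finset K).erase 1, p ^ fixDim (k : GLm p m)) =
      fixExcess K + (Fintype.card K - 1) := by
    have hs : ((Finset.univ : Finset K).erase 1).card = Fintype.card K - 1 := by
      rw [Finset.card_erase_of_mem (Finset.mem_univ _), Finset.card_univ]
    rw [← hs, Finset.card_eq_sum_ones, fixExcess, ← Finset.sum_add_distrib]
    exact Finset.sum_congr rfl fun k _ => (Nat.sub_add_cancel (Nat.one_le_pow _ _ hp1)).symm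
  rw [hsplit, hrest] at hB
  -- restate with the `Ω K` abbreviation so that `omega` sees one atom
  have hB' : p ^ m + (fixExcess K + (Fintype.card K - 1)) = Fintype.card (Ω K) * Fintype.card K := hB
  rw [Nat.card_eq_fintype_card, Nat.card_eq_fintype_card]
  have hpos : 1 ≤ Fintype.card K := Fintype.card_pos
  omega

/-! ## The evaluation of `|K| · dim (F_1)^K` -/

/-- **Evaluation for an arbitrary subgroup**: `|K| · dim (F_1)^K + |K| (b − 1) ≤ (p − 1) b² + b · Φ(K)`
(`m ≥ 1`, `b = #ℙ^{m-1}(𝔽_p)`).  For semiregular `K` (`Φ = 0`) this is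
`LevelOneInvariantDim.card_mul_finrank_le_of_semiregular`. -/
theorem card_mul_finrank_le (hm : 1 ≤ m) (K : Subgroup (GLm p m)) :
    Nat.card K * finrank ℂ (invRight K (levelSubmodule p m 1)) +
        Nat.card K * (Nat.card (ℙ (ZMod p) (Fin m → ZMod p)) - 1) ≤
      (p - 1) * Nat.card (ℙ (ZMod p) (Fin m → ZMod p)) ^ 2 +
        Nat.card (ℙ (ZMod p) (Fin m → ZMod p)) * fixExcess K := by
  obtain ⟨a₀, ha₀⟩ : ∃ a₀ : Fin m → ZMod p, a₀ ≠ 0 := by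
    refine ⟨fun _ => 1, fun h => ?_⟩
    have := congr_fun h ⟨0, hm⟩
    simp at this
  have h1 := finrank_invRight_levelOne_le K ha₀
  have h2 := card_orbits_mul_card K
  have h3 := LevelOneDim.card_proj_mul (p := p) (m := m)
  set b := Nat.card (ℙ (ZMod p) (Fin m → ZMod p)) with hb
  set d := finrank ℂ (invRight K (levelSubmodule p m 1))
  set n := Nat.card K
  set w := Nat.card (Ω K)
  set F := fixExcess K
  have hb1 : 1 ≤ b := by
    rw [hb]
    haveI : Nonempty (ℙ (ZMod p) (Fin m → ZMod p)) := ⟨Projectivization.mk (ZMod p) a₀ ha₀⟩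
    exact Nat.card_pos
  have hp1 : 1 ≤ p := hp.out.one_lt.le
  have hpm : p ^ m = b * (p - 1) + 1 := by
    have := Nat.one_le_pow m p hp1
    omega
  have hwn : w * n = b * (p - 1) + n + F := by omega
  have h4 : n * (d + 2 * b) ≤ n * (1 + w * b) := Nat.mul_le_mul_left n h1
  have h5 : n * (1 + w * b) = n + (b * (p - 1) + n + F) * b := by rw [← hwn]; ring
  rw [h5] at h4
  zify [hb1, hp1] at h4 ⊢
  linear_combination h4

/-! ## The fixed-point laws -/

/-- **FIXED-POINT LAW (third member), test form.**  TPP, a level-one identity test `f`, and ANY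
`K ≤ H₃`: `(x + y − 1) z + |K| (b − 1) ≤ (p − 1) b² + b Φ(K)`. -/
theorem law_right (hm : 1 ≤ m) {H₁ H₂ H₃ : Subgroup (GLm p m)} (htpp : SubgroupTPP H₁ H₂ H₃)
    {f : GLm p m → ℂ} (hf : f ∈ levelSubmodule p m 1) (h1 : f 1 = 1)
    (h0 : ∀ a ∈ H₁, ∀ b ∈ H₂, ∀ c ∈ H₃, a * b * c ≠ 1 → f (a * b * c) = 0)
    {K : Subgroup (GLm p m)} (hK : K ≤ H₃) :
    (Nat.card H₁ + (Nat.card H₂ - 1)) * Nat.card H₃ +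
        Nat.card K * (Nat.card (ℙ (ZMod p) (Fin m → ZMod p)) - 1) ≤
      (p - 1) * Nat.card (ℙ (ZMod p) (Fin m → ZMod p)) ^ 2 +
        Nat.card (ℙ (ZMod p) (Fin m → ZMod p)) * fixExcess K := by
  have hA := card_mul_le_card_mul_finrank_invRight (levelSubmodule p m 1) levelSubmodule_bi_inv htpp
    hf h1 h0 hK
  have hB := card_mul_finrank_le hm K
  omega

/-- **FIXED-POINT LAW (first member), test form**, by reversal: any `K ≤ H₁` gives
`(z + y − 1) x + |K| (b − 1) ≤ (p − 1) b² + b Φ(K)`. -/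
theorem law_left (hm : 1 ≤ m) {H₁ H₂ H₃ : Subgroup (GLm p m)} (htpp : SubgroupTPP H₁ H₂ H₃)
    {f : GLm p m → ℂ} (hf : f ∈ levelSubmodule p m 1) (h1 : f 1 = 1)
    (h0 : ∀ a ∈ H₁, ∀ b ∈ H₂, ∀ c ∈ H₃, a * b * c ≠ 1 → f (a * b * c) = 0)
    {K : Subgroup (GLm p m)} (hK : K ≤ H₁) :
    (Nat.card H₃ + (Nat.card H₂ - 1)) * Nat.card H₁ +
        Nat.card K * (Nat.card (ℙ (ZMod p) (Fin m → ZMod p)) - 1) ≤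
      (p - 1) * Nat.card (ℙ (ZMod p) (Fin m → ZMod p)) ^ 2 +
        Nat.card (ℙ (ZMod p) (Fin m → ZMod p)) * fixExcess K :=
  law_right hm (tpp_reverse htpp) (comp_inv_mem hf) (by simp only [inv_one]; exact h1)
    (test_reverse h0) hK

section Crux

variable {H₁ H₂ H₃ : Subgroup (GLm p m)}

/-- **FIXED-POINT LAW (third member), crux form**: hypotheses exactly those of a witness of
`SubgroupIdentityDesigns` at level `k = 1` (any `ε`), plus an arbitrary `K ≤ H₃`. -/
theorem crux_law_right (hm : 1 ≤ m) (htpp : SubgroupTPP H₁ H₂ H₃)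
    (hdes : ∃ c : Mat p m → ℂ, (∀ M, 1 < M.rank → c M = 0) ∧
      (∑ M, c M * ZMod.stdAddChar (Matrix.trace (M * ((1 : GLm p m) : Mat p m)))) = 1 ∧
      ∀ a ∈ H₁, ∀ b ∈ H₂, ∀ g ∈ H₃, a * b * g ≠ 1 →
        (∑ M, c M * ZMod.stdAddChar (Matrix.trace (M * ((a * b * g : GLm p m) : Mat p m)))) = 0)
    {K : Subgroup (GLm p m)} (hK : K ≤ H₃) :
    (Nat.card H₁ + (Nat.card H₂ - 1)) * Nat.card H₃ +
        Nat.card K * (Nat.card (ℙ (ZMod p) (Fin m → ZMod p)) - 1) ≤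
      (p - 1) * Nat.card (ℙ (ZMod p) (Fin m → ZMod p)) ^ 2 +
        Nat.card (ℙ (ZMod p) (Fin m → ZMod p)) * fixExcess K := by
  obtain ⟨f, hf, h1, h0⟩ := exists_test hdes
  exact law_right hm htpp hf h1 h0 hK

/-- **FIXED-POINT LAW (first member), crux form.** -/
theorem crux_law_left (hm : 1 ≤ m) (htpp : SubgroupTPP H₁ H₂ H₃)
    (hdes : ∃ c : Mat p m → ℂ, (∀ M, 1 < M.rank → c M = 0) ∧
      (∑ M, c M * ZMod.stdAddChar (Matrix.trace (M * ((1 : GLm p m) : Mat p m)))) = 1 ∧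
      ∀ a ∈ H₁, ∀ b ∈ H₂, ∀ g ∈ H₃, a * b * g ≠ 1 →
        (∑ M, c M * ZMod.stdAddChar (Matrix.trace (M * ((a * b * g : GLm p m) : Mat p m)))) = 0)
    {K : Subgroup (GLm p m)} (hK : K ≤ H₁) :
    (Nat.card H₃ + (Nat.card H₂ - 1)) * Nat.card H₁ +
        Nat.card K * (Nat.card (ℙ (ZMod p) (Fin m → ZMod p)) - 1) ≤
      (p - 1) * Nat.card (ℙ (ZMod p) (Fin m → ZMod p)) ^ 2 +
        Nat.card (ℙ (ZMod p) (Fin m → ZMod p)) * fixExcess K := by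
  obtain ⟨f, hf, h1, h0⟩ := exists_test hdes
  exact law_left hm htpp hf h1 h0 hK

/-- **MEMBER FORM (third member)**: `(x + y + b − 2) · z ≤ (p − 1) b² + b · Φ(H₃)` — the whole end
member `K = H₃`. -/
theorem crux_member_right (hm : 1 ≤ m) (htpp : SubgroupTPP H₁ H₂ H₃)
    (hdes : ∃ c : Mat p m → ℂ, (∀ M, 1 < M.rank → c M = 0) ∧
      (∑ M, c M * ZMod.stdAddChar (Matrix.trace (M * ((1 : GLm p m) : Mat p m)))) = 1 ∧
      ∀ a ∈ H₁, ∀ b ∈ H₂, ∀ g ∈ H₃, a * b * g ≠ 1 →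
        (∑ M, c M * ZMod.stdAddChar (Matrix.trace (M * ((a * b * g : GLm p m) : Mat p m)))) = 0) :
    (Nat.card H₁ + (Nat.card H₂ - 1) + (Nat.card (ℙ (ZMod p) (Fin m → ZMod p)) - 1)) *
        Nat.card H₃ ≤
      (p - 1) * Nat.card (ℙ (ZMod p) (Fin m → ZMod p)) ^ 2 +
        Nat.card (ℙ (ZMod p) (Fin m → ZMod p)) * fixExcess H₃ := by
  have h := crux_law_right hm htpp hdes (le_refl H₃)
  rw [Nat.add_mul]
  linarith [Nat.mul_comm (Nat.card H₃) (Nat.card (ℙ (ZMod p) (Fin m → ZMod p)) - 1)]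

/-- **MEMBER FORM (first member)**: `(z + y + b − 2) · x ≤ (p − 1) b² + b · Φ(H₁)`. -/
theorem crux_member_left (hm : 1 ≤ m) (htpp : SubgroupTPP H₁ H₂ H₃)
    (hdes : ∃ c : Mat p m → ℂ, (∀ M, 1 < M.rank → c M = 0) ∧
      (∑ M, c M * ZMod.stdAddChar (Matrix.trace (M * ((1 : GLm p m) : Mat p m)))) = 1 ∧
      ∀ a ∈ H₁, ∀ b ∈ H₂, ∀ g ∈ H₃, a * b * g ≠ 1 →
        (∑ M, c M * ZMod.stdAddChar (Matrix.trace (M * ((a * b * g : GLm p m) : Mat p m)))) = 0) :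
    (Nat.card H₃ + (Nat.card H₂ - 1) + (Nat.card (ℙ (ZMod p) (Fin m → ZMod p)) - 1)) *
        Nat.card H₁ ≤
      (p - 1) * Nat.card (ℙ (ZMod p) (Fin m → ZMod p)) ^ 2 +
        Nat.card (ℙ (ZMod p) (Fin m → ZMod p)) * fixExcess H₁ := by
  have h := crux_law_left hm htpp hdes (le_refl H₁)
  rw [Nat.add_mul]
  linarith [Nat.mul_comm (Nat.card H₁) (Nat.card (ℙ (ZMod p) (Fin m → ZMod p)) - 1)]

end Crux

end FixedPointLaw
end Summit.MatrixMultiplication.MatrixMultiplication.Theorems.SubgroupIdentityDesigns.Negative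

end
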